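import Literature.AlgebraicGeometry.Frobenioids.ArchimedeanFSMIProjectionA
import HarnessLib

/-!
# Frobenioids II, Proposition 3.4 (vi), FSMI clause: PROOF over an arbitrary base (tower `R`; assembly)
# (abc-iut cell, layer L1, node `FrdII:Prop3.4(vi)`; FACT-LIST row F-0823 `ArchFrd.Tower.PropVI_FSMI`)

Mochizuki, *The geometry of Frobenioids II: poly-Frobenioids*, Kyushu J. Math. **62** (2008)
401–460, §3, Proposition 3.4 (vi) p. 30 [cite: MochizukiFrdII2008, Prop 3.4 (vi) p.30]:

> "(vi) … In particular, … FSMI-morphisms of `F` project to either isomorphisms or FSMI-morphisms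
> of `D`." (kurims p. 30 ll. 21–22; "[cf. also assertion (iii)]" belongs to the PROOF, p. 31 l. 29)

PROOF-ONLY file (nothing is defined): the tower `R = R₀ ×_{D₀} D` (rigidified angloid) — companion
of `ArchimedeanFSMIProjection.lean` (`N`) and `ArchimedeanFSMIProjectionA.lean` (`A`), same
argument; the rigidifications ride along because a twisted endomorphism `x` of the domain with
`x ≫ φ₀ = φ₀` automatically satisfies `x ≫ h_P = x ≫ φ₀ ≫ h_Q = h_P`. Results: `R.mono_toD_of_isFSMI`,
**`R.propVI_FSMI : (towerR π).PropVI_FSMI` for every base `π`**, and the assembled instance forms of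
the FACT-LIST row `Tower.PropVI_FSMI` at the three named towers, `prop34_vi_fsmi` — the FSMI clause of
Prop. 3.4 (vi) AS TYPED, over every base, WITHOUT item (iii) (which is false as typed,
`ArchFrd.not_prop34_iii_id`) and without the complex-regime hypothesis of `prop34_vi_of_isComplex`.
Consequently the cell's bundled item `Prop34_vi π` holds for every `π`
(`⟨⟨A.propVI π, _, A.propVI_FSMI π⟩, …⟩` with `prop34_vi_main`, `prop34_vi_irreducible`; the
assembly of that row, F-0812, is left to its holder). No statement of the paper is strengthened; no
side is taken on [IUTchIII] Cor. 3.12.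
-/

namespace Literature.AlgebraicGeometry.Frobenioids

open CategoryTheory Set
open scoped Pointwise

noncomputable section

namespace ArchFrd

universe v u

variable {D : Type u} [Category.{v} D] (π : D ⥤ D0)

/-! ### The tower `R`: FSMI-morphisms project to monomorphisms of `D` -/

/-- **Monomorphy descends for `R`, complex isotropic domain over a real codomain.** Over an arbitrary
base `π : D ⥤ D₀`: a monomorphism `φ : P → Q` of `R` with `P = ((Spec ℂ, A_P) → [ℝ-unit], P_D, ι_P)`,
`A_P` isotropic, and `Q` over `Spec ℝ` projects to a monomorphism `φ_D` of `D` — two arrows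
`u, v : E → P_D` with `u ≫ φ_D = v ≫ φ_D` lift to arrows of `R` out of `(P₀ → [ℝ-unit], E, ·)` with
equal composites with `φ` (`C0.exists_twist_endo_comp_eq`; the lifts respect the rigidification
because `h_P = φ₀ ≫ h_Q`). [cite: MochizukiFrdII2008, Prop 3.4 (vi) p.30] -/
theorem R.mono_toD_of_mono_of_isIsotropic {RP : AngularRegion ℂ}
    (hRP : D0.complex = D0.real → RP.IsIsotropic) (hisoP : RP.IsIsotropic)
    (hP : (⟨⟨C0.mk D0.complex RP hRP⟩⟩ : N0) ⟶ N0.realUnit) {PD : D}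
    (ιP : R0.toD0.obj (Over.mk hP) ≅ π.obj PD)
    {RQ : AngularRegion ℂ} (hRQ : D0.real = D0.real → RQ.IsIsotropic)
    (hQ : (⟨⟨C0.mk D0.real RQ hRQ⟩⟩ : N0) ⟶ N0.realUnit) {QD : D}
    (ιQ : R0.toD0.obj (Over.mk hQ) ≅ π.obj QD)
    (φ : (⟨Over.mk hP, PD, ιP⟩ : R π) ⟶ ⟨Over.mk hQ, QD, ιQ⟩)
    (hφm : Mono φ) : Mono ((towerR π).toD.map φ) := by
  refine ⟨fun {E} u v huv => ?_⟩
  change u ≫ φ.snd = v ≫ φ.snd at huv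
  set φN := φ.fst.left with hφNdef
  set φ0 : C0.mk D0.complex RP hRP ⟶ C0.mk D0.real RQ hRQ := N0.homCarrier φN with hφ0def
  have hd : C0.degFr φ0 = 1 := φN.property
  have hw0 : φN ≫ hQ = hP := Over.w φ.fst
  -- `E` lies over `Spec ℂ`
  have hE : π.obj E = D0.complex :=
    D0.eq_complex_of_hom_complex (π.map u ≫ ιP.inv : π.obj E ⟶ D0.complex)
  let ιV : R0.toD0.obj (Over.mk hP) ≅ π.obj E := eqToIso hE.symm
  let V : R π := ⟨Over.mk hP, E, ιV⟩
  let P : R π := ⟨Over.mk hP, PD, ιP⟩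
  -- the lift of an arrow `w : E → P_D` to an arrow `V → P` of `R` with composite `φ₀` downstairs
  have lift : ∀ w : E ⟶ PD, ∃ x : V ⟶ P, N0.homCarrier x.fst.left ≫ φ0 = φ0 ∧ x.snd = w := by
    intro w
    obtain ⟨x0, hb, hdx, hI, hcomp⟩ :=
      C0.exists_twist_endo_comp_eq hRP hisoP hRQ φ0 (ιV.hom ≫ π.map w ≫ ιP.inv)
    let xN : (⟨⟨C0.mk D0.complex RP hRP⟩⟩ : N0) ⟶ ⟨⟨C0.mk D0.complex RP hRP⟩⟩ := N0.homMk x0 hI hdx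
    have hxφ : xN ≫ φN = φN := N0.hom_ext (by rw [N0.homCarrier_comp]; exact hcomp)
    have hxP : xN ≫ hP = hP := by
      rw [← hw0]
      exact (Category.assoc xN φN hQ).symm.trans (congrArg (· ≫ hQ) hxφ)
    let xO : Over.mk hP ⟶ Over.mk hP := Over.homMk xN hxP
    have sq : R0.toD0.map xO ≫ ιP.hom = ιV.hom ≫ π.map w := by
      have hb' : R0.toD0.map xO = ιV.hom ≫ π.map w ≫ ιP.inv := hb
      rw [hb', Category.assoc, Category.assoc, ιP.inv_hom_id, Category.comp_id]
    exact ⟨⟨xO, w, sq⟩, hcomp, rfl⟩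
  obtain ⟨a, ha0, haD⟩ := lift u
  obtain ⟨b, hb0, hbD⟩ := lift v
  have hab : a ≫ φ = b ≫ φ := by
    refine CFP.hom_ext (Over.OverMorphism.ext (N0.hom_ext ?_)) ?_
    · show N0.homCarrier a.fst.left ≫ φ0 = N0.homCarrier b.fst.left ≫ φ0
      rw [ha0, hb0]
    · show a.snd ≫ φ.snd = b.snd ≫ φ.snd
      rw [haD, hbD]
      exact huv
  haveI := hφm
  have h := congrArg (fun f => f.snd) ((cancel_mono φ).mp hab)
  simp only [haD, hbD] at h
  exact h

/-- **An FSMI-morphism of `R` projects to a monomorphism of `D`**, over an arbitrary base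
`π : D ⥤ D₀`. If `φ` projects to an isomorphism of `D₀` this is condition (a) of Prop. 3.4 (ii)
(`R.propII_condA`). Otherwise `φ : P → Q` lies over `Spec ℂ → Spec ℝ`; the angular region of `P` is
isotropic — else `φ` factors through the naive isotropic hull of `P` rigidified through `Q`
(`C0.exists_hull_fac`) with neither factor invertible, contradicting irreducibility — and then
monomorphy descends (`R.mono_toD_of_mono_of_isIsotropic`). [cite: MochizukiFrdII2008, Prop 3.4 (vi) p.30] -/
theorem R.mono_toD_of_isFSMI {P Q : R π} (φ : P ⟶ Q) (hφ : IsFSMI φ) :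
    Mono ((towerR π).toD.map φ) := by
  by_cases hA : IsIso ((towerR π).toD0.map φ)
  · exact R.propII_condA π φ hφ.1.2 hA
  obtain ⟨⟨⟨⟨⟨KP, RP, hRP⟩⟩⟩, ⟨⟨⟩⟩, hP⟩, PD, ιP⟩ := P
  obtain ⟨⟨⟨⟨⟨KQ, RQ, hRQ⟩⟩⟩, ⟨⟨⟩⟩, hQ⟩, QD, ιQ⟩ := Q
  set φN := φ.fst.left with hφNdef
  set φ0 : C0.mk KP RP hRP ⟶ C0.mk KQ RQ hRQ := N0.homCarrier φN with hφ0def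
  -- the base arrow of `φ₀` is not invertible, so it is `Spec ℂ → Spec ℝ`
  have hB : ¬ IsIso (R0.toD0.map φ.fst) := by
    intro h
    apply hA
    have hw : R0.toD0.map φ.fst ≫ ιQ.hom = ιP.hom ≫ π.map φ.snd := φ.w
    change IsIso (π.map φ.snd)
    rw [← (Iso.inv_comp_eq ιP).mpr hw]
    infer_instance
  have hKP : KP = D0.complex := (D0.eq_of_not_isIso (C0.Base φ0) hB).1
  have hKQ : KQ = D0.real := (D0.eq_of_not_isIso (C0.Base φ0) hB).2
  subst hKP hKQ
  by_cases hisoP : RP.IsIsotropic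
  · exact R.mono_toD_of_mono_of_isIsotropic π hRP hisoP hP ιP hRQ hQ ιQ φ hφ.1.2
  · -- factor through the naive isotropic hull (rigidified through `Q`): neither factor is invertible
    exfalso
    have hd : C0.degFr φ0 = 1 := φN.property
    have hI : PreFrobenioid.IsIsometry C0.toElem φ0 := φN.hom.property
    obtain ⟨β0, α0, hβα, hbβ, hdβ, hβI, hdα, hαI⟩ := C0.exists_hull_fac hRP hRQ φ0 hI
    let RP' : AngularRegion ℂ := AngularRegion.isotropicOfTip RP.tip
    have hRP' : D0.complex = D0.real → RP'.IsIsotropic := fun h => nomatch h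
    -- in `N₀` and `R₀`
    let PN : N0 := ⟨⟨C0.mk D0.complex RP hRP⟩⟩
    let P'N : N0 := ⟨⟨C0.mk D0.complex RP' hRP'⟩⟩
    let QN : N0 := ⟨⟨C0.mk D0.real RQ hRQ⟩⟩
    let βN : PN ⟶ P'N := N0.homMk β0 hβI hdβ
    let αN : P'N ⟶ QN := N0.homMk α0 hαI (hdα.trans hd)
    have hβαN : βN ≫ αN = φN := N0.hom_ext hβα
    let P'O : R0 := Over.mk (αN ≫ hQ)
    let αO : P'O ⟶ Over.mk hQ := Over.homMk αN rfl
    have hβw : βN ≫ (αN ≫ hQ) = hP := by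
      rw [← Category.assoc, hβαN]
      exact Over.w φ.fst
    let βO : Over.mk hP ⟶ P'O := Over.homMk βN hβw
    -- in `R`
    let PR : R π := ⟨Over.mk hP, PD, ιP⟩
    let P'R : R π := ⟨P'O, PD, ιP⟩
    let QR : R π := ⟨Over.mk hQ, QD, ιQ⟩
    have sqβ : R0.toD0.map βO ≫ ιP.hom = ιP.hom ≫ π.map (𝟙 PD) := by
      show C0.Base β0 ≫ ιP.hom = ιP.hom ≫ π.map (𝟙 PD)
      rw [hbβ, π.map_id]
      exact (Category.id_comp _).trans (Category.comp_id _).symm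
    let β : PR ⟶ P'R := ⟨βO, 𝟙 PD, sqβ⟩
    have wα : R0.toD0.map αO ≫ ιQ.hom = ιP.hom ≫ π.map φ.snd := by
      have hw : R0.toD0.map φ.fst ≫ ιQ.hom = ιP.hom ≫ π.map φ.snd := φ.w
      have hbα : C0.Base α0 = C0.Base φ0 :=
        (D0.hom_complex_real_eq _).trans (D0.hom_complex_real_eq _).symm
      change C0.Base α0 ≫ ιQ.hom = ιP.hom ≫ π.map φ.snd
      rw [hbα]
      exact hw
    let α : P'R ⟶ QR := ⟨αO, φ.snd, wα⟩
    have hfac : β ≫ α = φ := by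
      refine CFP.hom_ext (Over.OverMorphism.ext ?_) (Category.id_comp _)
      show βN ≫ αN = φN
      exact hβαN
    rcases hφ.2.2 β α hfac with hα | hβ
    · obtain ⟨g, -, -⟩ := hα.out
      exact (D0.isEmpty_hom_real_complex.false (C0.Base (N0.homCarrier g.fst.left))).elim
    · obtain ⟨g, -, -⟩ := hβ.out
      exact C0.not_isIsotropic_elim hRP hisoP (N0.homCarrier g.fst.left)

/-- **Proposition 3.4 (vi), FSMI clause, for `F = R` — PROVED AS TYPED over every base**:
"FSMI-morphisms of `F` project to either isomorphisms or FSMI-morphisms of `D`" — fiberwise-surjective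
by item (i) (`prop34_i_holds`), mono by `R.mono_toD_of_isFSMI`, irreducible-or-invertible by the main
clause of (vi) (`prop34_vi_irreducible`). [cite: MochizukiFrdII2008, Prop 3.4 (vi) p.30] -/
theorem R.propVI_FSMI : (towerR π).PropVI_FSMI := by
  intro P Q φ hφ
  rcases (prop34_vi_irreducible π).2.2 φ hφ.2 with hiso | hirr
  · exact Or.inl hiso
  · exact Or.inr ⟨⟨(prop34_i_holds π).2.2 φ hφ.1.1, R.mono_toD_of_isFSMI π φ hφ⟩, hirr⟩

/-! ### Proposition 3.4 (vi), FSMI clause, for `F = A, N, R` -/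

/-- **Proposition 3.4 (vi), "FSMI-morphisms of `F` project to either isomorphisms or FSMI-morphisms
of `D`", PROVED AS TYPED for `F = A, N, R` over EVERY base `π : D ⥤ D₀`** — the instance forms of the
per-tower predicate `ArchFrd.Tower.PropVI_FSMI` at the three named towers (FACT-LIST row F-0823),
with no hypothesis: no item (iii), no complex regime, no total epimorphicity of `D`.
[cite: MochizukiFrdII2008, Prop 3.4 (vi) p.30] -/
theorem prop34_vi_fsmi :
    (towerA π).PropVI_FSMI ∧ (towerN π).PropVI_FSMI ∧ (towerR π).PropVI_FSMI :=
  ⟨A.propVI_FSMI π, N.propVI_FSMI π, R.propVI_FSMI π⟩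

end ArchFrd

end

end Literature.AlgebraicGeometry.Frobenioids
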